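import Literature.NumberTheory.GaloisRepresentations.PotentialDiagonalizability
import HarnessLib

/-!
# Potential diagonalizability criteria (Barnet-Lamb–Gee–Geraghty–Taylor 2014, Lemma 1.4.3 (1))

Companion of `PotentialDiagonalizability.lean` (the predicates `IsCrystallineFn`, `ConnectsOver`,
`IsDiagonalizableOver`, `IsPotentiallyDiagonalizable 𝔅 ρ` for a continuous `ρ : Γ_K → GL_n(ℚ̄_p)`,
relative to crystalline period-ring data `𝔅 : CrystallineExtensionData p K`), whose module
docstring defers "the named facts of BLGGT §1.4 … Lemma 1.4.3" to cite items.  Ledger cite item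
`PDCalculusFacts` (filed for route `Langlands/WachCensus`, since retired; the criterion below is the
`l = p` input of every BLGGT-type potentially-diagonalizable lifting theorem, e.g. the tree's
`PDLiftingGL2` requests).

**Source (held, read: arXiv:1010.2561, §1.4, pp. 14–15).**  T. Barnet-Lamb, T. Gee, D. Geraghty,
R. Taylor, *Potential automorphy and change of weight*, Ann. of Math. 179 (2014):

* §1.4: "We will call a representation `ρ : G_K → GL_n(𝒪_{ℚ̄_l})` diagonalizable if it is crystalline
  and connects to some representation `χ₁ ⊕ ⋯ ⊕ χ_n` with `χ_i : G_K → 𝒪_{ℚ̄_l}^×` crystalline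
  characters.  We will call a representation … potentially diagonalizable if there is a finite
  extension `K'/K` such that `ρ|_{G_{K'}}` is diagonalizable."
* **Lemma 1.4.3.** "Keep the above notation, including the assumption `l = p` [`K/ℚ_l` finite].
  Suppose that `ρ : G_K → GL_n(ℚ̄_l)` is a potentially crystalline representation.
  (1) If `ρ` has a `G_K`-invariant filtration with one dimensional graded pieces, in particular if it
  is ordinary, then `ρ` is potentially diagonalizable.
  (2) If `K/ℚ_l` is unramified, if `ρ` is crystalline and if for each `τ : K ↪ L̄` the Hodge–Tate
  numbers `HT_τ(ρ) ⊂ [a_τ, a_τ + l − 2]` for some integer `a_τ`, then `ρ` is potentially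
  diagonalizable."  Proof of (1): "After passing to a finite extension so that `ρ̄` becomes trivial
  and each `gr^i ρ` becomes crystalline, the first part follows from item (semisimp) [an invariant
  filtration by `𝒪`-direct summands with `ρ̄` semisimple gives `ρ ~ ⊕ gr^i ρ`]."

## Contents

* `FramedGaloisRep.IsPotentiallyCrystallineFn 𝔅 ρ` — `ρ|_{Γ_{K'}}` is crystalline
  (`IsCrystallineFn`, models over finite `E'/ℚ_p`) relative to `𝔅 K'` for some finite `K'/K` inside
  `K̄` (the hypothesis "potentially crystalline" of Lemma 1.4.3, relative to the same data as the
  conclusion);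
* `FramedRep.HasInvariantCompleteFlag ρ` — "`ρ` has a `G`-invariant filtration with one-dimensional
  graded pieces": some conjugate `P ρ P⁻¹` is upper triangular (a complete flag of `A^n` stable under
  `ρ(G)` is the standard flag after a change of frame), with the API lemmas
  `hasInvariantCompleteFlag_of_upperTriangular` (`P = 1`), `HasInvariantCompleteFlag.conj`;
* the NAMED FACT `blggt2014_lemma_1_4_3_1` — Lemma 1.4.3 (1) over the tree's
  `IsPotentiallyDiagonalizable`, for `K/ℚ_p` finite.

Not here: Lemma 1.4.3 (2) (needs the `p`-adic notion "`K/ℚ_p` unramified", `e(K/ℚ_p) = 1`, and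
LABELLED Hodge–Tate weights — the tree's `PeriodRingData.hodgeTateWeights` is unlabelled); the
`~`-calculus of §1.4 (equivalence relation, restriction, `⊕`, `⊗`, duals, unramified twists,
filtrations), which needs direct sums / tensor products / duals / twists of `FramedGaloisRep` as
definitions first; Lemma 1.4.1 is the proved `isPotentiallyDiagonalizable_conj_iff` of the companion
file.

## References

* T. Barnet-Lamb, T. Gee, D. Geraghty, R. Taylor, Ann. of Math. 179 (2014) 501–609, §1.4,
  Lemma 1.4.3 (arXiv:1010.2561 pp. 14–15). [BarnetlambEtAl2014]
-/

noncomputable section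

open scoped Matrix
open Field

namespace Literature.NumberTheory.GaloisRepresentations

universe u v w

/-! ### Invariant complete flags ("a `G`-invariant filtration with one-dimensional graded pieces") -/

section Flag

variable {G : Type u} [Group G] [TopologicalSpace G] {A : Type v} [CommRing A] [TopologicalSpace A]
  [IsTopologicalRing A] {n : ℕ}

/-- **`ρ` has a `G`-invariant filtration with one-dimensional graded pieces** (BLGGT Lemma 1.4.3 (1):
"in particular if it is ordinary"): there is a change of frame `P ∈ GL_n(A)` such that every
`P ρ(g) P⁻¹` is upper triangular, i.e. `ρ(G)` stabilises a complete flag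
`0 = V₀ ⊂ V₁ ⊂ ⋯ ⊂ V_n = Aⁿ` (after the change of frame, `V_i = ⟨e₁, …, e_i⟩`), the graded pieces
`V_i/V_{i−1}` being the one-dimensional representations given by the diagonal entries.
[cite: BarnetlambEtAl2014, §1.4 Lemma 1.4.3 (1)] -/
def FramedRep.HasInvariantCompleteFlag (ρ : FramedRep G A n) : Prop :=
  ∃ P : GL (Fin n) A, ∀ (g : G) (i j : Fin n), j < i → (FramedRep.conj P ρ).matrixFn g i j = 0

/-- An upper-triangular representation has an invariant complete flag (`P = 1`). [folklore] -/
theorem FramedRep.hasInvariantCompleteFlag_of_upperTriangular (ρ : FramedRep G A n)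
    (h : ∀ (g : G) (i j : Fin n), j < i → ρ.matrixFn g i j = 0) :
    ρ.HasInvariantCompleteFlag := by
  refine ⟨1, fun g i j hij => ?_⟩
  have e : (FramedRep.conj 1 ρ).matrixFn g = ρ.matrixFn g := by
    simp [FramedRep.matrixFn]
  rw [e]
  exact h g i j hij

/-- Having an invariant complete flag is invariant under a change of frame. [folklore] -/
theorem FramedRep.HasInvariantCompleteFlag.conj {ρ : FramedRep G A n} (h : ρ.HasInvariantCompleteFlag)
    (Q : GL (Fin n) A) : (FramedRep.conj Q ρ).HasInvariantCompleteFlag := by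
  obtain ⟨P, hP⟩ := h
  refine ⟨P * Q⁻¹, fun g i j hij => ?_⟩
  have e : (FramedRep.conj (P * Q⁻¹) (FramedRep.conj Q ρ)).matrixFn g =
      (FramedRep.conj P ρ).matrixFn g := by
    simp [FramedRep.matrixFn, mul_assoc]
  rw [e]
  exact hP g i j hij

end Flag

/-! ### Potentially crystalline, relative to crystalline extension data -/

section Crystalline

variable {p : ℕ} [Fact p.Prime] {K : Type u} [Field K] [Algebra ℚ_[p] K] {n : ℕ}

/-- **`ρ` is potentially crystalline** (relative to the crystalline period-ring data `𝔅` along the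
finite extensions of `K` inside `K̄`, as all notions of `PotentialDiagonalizability.lean`): for some
finite `K'/K` inside `K̄` the matrix-valued function of `ρ|_{Γ_{K'}}` is crystalline relative to
`𝔅 K'` (`IsCrystallineFn`: every model over a finite `E'/ℚ_p` is `B`-admissible).  This is the
standing hypothesis "`ρ : G_K → GL_n(ℚ̄_l)` is a potentially crystalline representation" of BLGGT
Lemma 1.4.3, rendered relative to the same data as its conclusion. [cite: BarnetlambEtAl2014, §1.4 Lemma 1.4.3] -/
def FramedGaloisRep.IsPotentiallyCrystallineFn (𝔅 : CrystallineExtensionData.{u, w} p K)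
    (ρ : FramedGaloisRep K (PadicAlgCl p) n) : Prop :=
  ∃ (K' : IntermediateField K (AlgebraicClosure K)) (hK' : FiniteDimensional K K'),
    IsCrystallineFn (𝔅 K' hK') (ρ.restrictField K').matrixFn

/-- A representation crystalline over `K` itself (relative to `𝔅 ⊥`) is potentially crystalline.
[folklore] -/
theorem FramedGaloisRep.isPotentiallyCrystallineFn_of_bot (𝔅 : CrystallineExtensionData.{u, w} p K)
    (ρ : FramedGaloisRep K (PadicAlgCl p) n)
    (h : IsCrystallineFn (𝔅 ⊥ inferInstance)
      (ρ.restrictField (⊥ : IntermediateField K (AlgebraicClosure K))).matrixFn) :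
    ρ.IsPotentiallyCrystallineFn 𝔅 :=
  ⟨⊥, inferInstance, h⟩

end Crystalline

/-! ### The named fact: Lemma 1.4.3 (1) -/

/-- **Barnet-Lamb–Gee–Geraghty–Taylor 2014, Lemma 1.4.3 (1)** — "Suppose that
`ρ : G_K → GL_n(ℚ̄_l)` is a potentially crystalline representation [`K/ℚ_l` finite, `l = p`].  If
`ρ` has a `G_K`-invariant filtration with one dimensional graded pieces, in particular if it is
ordinary, then `ρ` is potentially diagonalizable."  Tree rendering: for `K/ℚ_p` finite, crystalline
extension data `𝔅` for `K`, and a continuous `ρ : Γ_K → GL_n(ℚ̄_p)` which is potentially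
crystalline relative to `𝔅` (`IsPotentiallyCrystallineFn`) and stabilises a complete flag
(`HasInvariantCompleteFlag`: conjugate into upper-triangular matrices), `ρ` is potentially
diagonalizable in the sense of `IsPotentiallyDiagonalizable 𝔅 ρ` (for some finite `K'/K` and frame,
`ρ|_{Γ_{K'}}` is crystalline and connects to a crystalline sum of characters).  Named fact (D-0014),
not proved here (printed proof: pass to `K'` trivialising `ρ̄` and making the graded characters
crystalline, then `ρ ~ ⊕ gr^i ρ` by the filtration remark of §1.4).
[cite: BarnetlambEtAl2014, §1.4 Lemma 1.4.3 (1)] -/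
def blggt2014_lemma_1_4_3_1 : Prop :=
  ∀ (p : ℕ) [Fact p.Prime] (K : Type) [Field K] [Algebra ℚ_[p] K] [FiniteDimensional ℚ_[p] K]
    (𝔅 : CrystallineExtensionData.{0, w} p K) (n : ℕ) (ρ : FramedGaloisRep K (PadicAlgCl p) n),
    ρ.IsPotentiallyCrystallineFn 𝔅 → FramedRep.HasInvariantCompleteFlag ρ →
      IsPotentiallyDiagonalizable 𝔅 ρ

/-- Lemma 1.4.3 (1) for an UPPER-TRIANGULAR potentially crystalline `ρ` (the ordinary shape as it is
usually presented: no change of frame needed). [cite: BarnetlambEtAl2014, §1.4 Lemma 1.4.3 (1)] -/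
theorem blggt2014_lemma_1_4_3_1.of_upperTriangular (h : blggt2014_lemma_1_4_3_1.{w})
    {p : ℕ} [Fact p.Prime] {K : Type} [Field K] [Algebra ℚ_[p] K] [FiniteDimensional ℚ_[p] K]
    (𝔅 : CrystallineExtensionData.{0, w} p K) {n : ℕ} (ρ : FramedGaloisRep K (PadicAlgCl p) n)
    (hcris : ρ.IsPotentiallyCrystallineFn 𝔅)
    (htri : ∀ (σ : absoluteGaloisGroup K) (i j : Fin n), j < i → ρ.matrixFn σ i j = 0) :
    IsPotentiallyDiagonalizable 𝔅 ρ :=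
  h p K 𝔅 n ρ hcris (FramedRep.hasInvariantCompleteFlag_of_upperTriangular ρ htri)

end Literature.NumberTheory.GaloisRepresentations

end
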